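import Summits.Ventures.LatticeQCDFlow.Scoring.SU2TorusPlaquette
import Summits.Ventures.LatticeQCDFlow.Scoring.U1TorusPlaquetteBounds
import Literature.Analysis.FunctionSpaces.BesselIIntegralSeries
import HarnessLib

/-!
# SU(2) on the 2-torus: the finite-volume correction of the plaquette is `O((I₂(2β)/I₁(2β))^{L²−1})`

HONEST FRAMING: exact (Metropolis-corrected) sampling algorithms for lattice gauge theory;
figures of merit are autocorrelation/cost numbers at stated couplings and volumes; no
continuum-physics claim.

Venture `LatticeQCDFlow` (cell pub-lqcd), sub-topic `Scoring`; FANOUT row 5 (`s0-sun-a`), GEN-10.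
NEW WORK of the cell (placement rule).  `SU2TorusPlaquette.wilson_mean_su2a0_plaquette_two` gives the
exact plaquette of the `L × L` torus as a ratio of two series in the dimension-normalised character
coefficients `w_n = c_n/(n+1) = e^{−2β} I_{n+1}(2β)/β`.  Both series are dominated by their `n = 0`
terms, and the ratio is the infinite-volume value `w_1/w_0 = I₂(2β)/I₁(2β)` (the cell's reference
one-plaquette table at `b = 2β`, `Scoring/OnePlaquetteBessel`) up to an EXPONENTIALLY SMALL volume
correction:

* `abs_div_tsum_sub_le` — the abstract estimate: for an antitone, positive, summable `w : ℕ → ℝ`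
  and `V ≥ 1`, with `Z = Σ_n w_n^V` and
  `N = ½ Σ_n [(n+1)/(n+2)·w_n w_{n+1}^{V−1} + (n+2)/(n+1)·w_{n+1} w_n^{V−1}]`:
  `|N/Z − w_1/w_0| ≤ (w_1/w_0)^{V−1} · (¼ + (5/2)·(Σ_n w_{n+1})/w_0)`;
* **`abs_wilson_mean_su2a0_plaquette_two_sub_le`** — for `β > 0`, every `L ≥ 1` and plaquette `x₀`:
  `|⟨½ tr U_{x₀}⟩_{(ℤ/L)²,β} − I₂(2β)/I₁(2β)| ≤ (I₂(2β)/I₁(2β))^{L²−1}·(¼ + (5/2)·Σ_n I_{n+2}(2β)/I₁(2β))`.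
  At the cell's SU(2) keys (`b = 2β = 1.8 … 2.7`, `L = 16`) the right-hand side is below `10^{−60}`:
  the finite-volume torus plaquette and the infinite-volume Bessel ratio agree far beyond float64
  (ORACLE-TABLE-S0-C-A's 'P(L) − P(∞)' column for SU(2), now with a proof).

Elementary real analysis on the typed series; nothing is cited; no `def`.
-/

noncomputable section

open Real MeasureTheory Set Function Finset Polynomial.Chebyshev
open Literature.MathematicalPhysics.QuantumFieldTheory Literature.MathematicalPhysics.QuantumLattice
open Literature.Analysis.FunctionSpaces
open Summit.Ventures.LatticeQCDFlow.Exactness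
open Summit.Ventures.LatticeQCDFlow.Theory2.Lattice

namespace Summit.Ventures.LatticeQCDFlow.Scoring

/-! ## §1. The abstract two-series estimate -/

section Abstract

variable {w : ℕ → ℝ} (hanti : Antitone w) (hpos : ∀ n, 0 < w n) (hsum : Summable w)
include hanti hpos hsum

/-- Powers of an antitone positive summable sequence are summable: `Σ_n w_{n+k}·w_m^{j} …`; here the
basic comparison `w_n^V ≤ w_0^{V−1} w_n`. -/
theorem summable_pow_of_antitone (V : ℕ) (hV : 1 ≤ V) : Summable fun n => w n ^ V := by
  obtain ⟨V', rfl⟩ : ∃ V', V = V' + 1 := ⟨V - 1, by omega⟩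
  refine Summable.of_nonneg_of_le (fun n => pow_nonneg (hpos n).le _)
    (fun n => ?_) (hsum.mul_left (w 0 ^ V'))
  rw [pow_succ]
  exact mul_le_mul_of_nonneg_right (pow_le_pow_left₀ (hpos n).le (hanti (Nat.zero_le n)) V')
    (hpos n).le

/-- The numerator terms are summable. -/
theorem summable_numTerm (V : ℕ) :
    Summable fun n : ℕ => (1 / 2 : ℝ) * (((n : ℝ) + 1) / ((n : ℝ) + 2) * (w n * w (n + 1) ^ (V - 1)) +
      ((n : ℝ) + 2) / ((n : ℝ) + 1) * (w (n + 1) * w n ^ (V - 1))) := by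
  have hb : ∀ n : ℕ, (1 / 2 : ℝ) * (((n : ℝ) + 1) / ((n : ℝ) + 2) * (w n * w (n + 1) ^ (V - 1)) +
      ((n : ℝ) + 2) / ((n : ℝ) + 1) * (w (n + 1) * w n ^ (V - 1))) ≤
      (1 / 2 : ℝ) * (w 0 ^ (V - 1) * w n + 2 * (w 0 ^ (V - 1) * w (n + 1))) := by
    intro n
    have h1 : ((n : ℝ) + 1) / ((n : ℝ) + 2) ≤ 1 := by
      rw [div_le_one (by positivity)]; linarith
    have h2 : ((n : ℝ) + 2) / ((n : ℝ) + 1) ≤ 2 := by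
      rw [div_le_iff₀ (by positivity)]; linarith
    have hp1 : w (n + 1) ^ (V - 1) ≤ w 0 ^ (V - 1) :=
      pow_le_pow_left₀ (hpos _).le (hanti (Nat.zero_le _)) _
    have hp2 : w n ^ (V - 1) ≤ w 0 ^ (V - 1) :=
      pow_le_pow_left₀ (hpos _).le (hanti (Nat.zero_le _)) _
    have hwn := (hpos n).le
    have hwn1 := (hpos (n + 1)).le
    have hA : ((n : ℝ) + 1) / ((n : ℝ) + 2) * (w n * w (n + 1) ^ (V - 1)) ≤ w 0 ^ (V - 1) * w n := by
      calc ((n : ℝ) + 1) / ((n : ℝ) + 2) * (w n * w (n + 1) ^ (V - 1))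
          ≤ 1 * (w n * w (n + 1) ^ (V - 1)) :=
            mul_le_mul_of_nonneg_right h1 (by positivity)
        _ ≤ w 0 ^ (V - 1) * w n := by
            rw [one_mul, mul_comm]; exact mul_le_mul_of_nonneg_right hp1 hwn
    have hB : ((n : ℝ) + 2) / ((n : ℝ) + 1) * (w (n + 1) * w n ^ (V - 1)) ≤
        2 * (w 0 ^ (V - 1) * w (n + 1)) := by
      calc ((n : ℝ) + 2) / ((n : ℝ) + 1) * (w (n + 1) * w n ^ (V - 1))
          ≤ 2 * (w (n + 1) * w n ^ (V - 1)) :=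
            mul_le_mul_of_nonneg_right h2 (by positivity)
        _ ≤ 2 * (w 0 ^ (V - 1) * w (n + 1)) := by
            rw [mul_comm (w (n + 1))]
            exact mul_le_mul_of_nonneg_left (mul_le_mul_of_nonneg_right hp2 hwn1) (by norm_num)
    linarith
  refine Summable.of_nonneg_of_le (fun n => ?_) hb ?_
  · have := (hpos n).le; have := (hpos (n + 1)).le; positivity
  · exact ((hsum.mul_left _).add (((summable_nat_add_iff 1).mpr hsum).mul_left _ |>.mul_left 2)).mul_left _

/-- **The abstract two-series estimate.**  For an antitone, positive, summable `w : ℕ → ℝ` and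
`V ≥ 1`: with `Z = Σ_n w_n^V` and `N = ½ Σ_n [(n+1)/(n+2)·w_n w_{n+1}^{V−1} + (n+2)/(n+1)·w_{n+1} w_n^{V−1}]`,
`|N/Z − w_1/w_0| ≤ (w_1/w_0)^{V−1} · (¼ + (5/2)·(Σ_n w_{n+1})/w_0)` — both series are their `n = 0`
terms up to `O(w_1^{V−1})`, and the `n = 0` terms have ratio exactly `w_1/w_0` up to `¼ w_0 w_1^{V−1}`. -/
theorem abs_div_tsum_sub_le (V : ℕ) (hV : 1 ≤ V) :
    |(∑' n : ℕ, (1 / 2 : ℝ) * (((n : ℝ) + 1) / ((n : ℝ) + 2) * (w n * w (n + 1) ^ (V - 1)) +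
        ((n : ℝ) + 2) / ((n : ℝ) + 1) * (w (n + 1) * w n ^ (V - 1)))) / (∑' n : ℕ, w n ^ V) -
      w 1 / w 0| ≤
      (w 1 / w 0) ^ (V - 1) * (1 / 4 + 5 / 2 * (∑' n : ℕ, w (n + 1)) / w 0) := by
  obtain ⟨V', rfl⟩ : ∃ V', V = V' + 1 := ⟨V - 1, by omega⟩
  simp only [Nat.add_sub_cancel]
  set N : ℝ := ∑' n : ℕ, (1 / 2 : ℝ) * (((n : ℝ) + 1) / ((n : ℝ) + 2) * (w n * w (n + 1) ^ V') +
    ((n : ℝ) + 2) / ((n : ℝ) + 1) * (w (n + 1) * w n ^ V')) with hN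
  set Z : ℝ := ∑' n : ℕ, w n ^ (V' + 1) with hZ
  set S : ℝ := ∑' n : ℕ, w (n + 1) with hS
  have hw0 := hpos 0
  have hw1 := hpos 1
  have hS0 : 0 ≤ S := tsum_nonneg fun n => (hpos _).le
  have hsumZ : Summable fun n => w n ^ (V' + 1) := summable_pow_of_antitone hanti hpos hsum _ (by omega)
  have hsumN := summable_numTerm hanti hpos hsum (V' + 1)
  simp only [Nat.add_sub_cancel] at hsumN
  have hsumS : Summable fun n => w (n + 1) := (summable_nat_add_iff 1).mpr hsum
  -- `Z ≥ w_0^V > 0`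
  have hZge : w 0 ^ (V' + 1) ≤ Z :=
    hsumZ.le_tsum 0 (fun j _ => pow_nonneg (hpos j).le _)
  have hZpos : 0 < Z := lt_of_lt_of_le (pow_pos hw0 _) hZge
  -- the difference `N − (w_1/w_0) Z` as one series, its `n = 0` term, and the tail bound
  set D : ℕ → ℝ := fun n => (1 / 2 : ℝ) * (((n : ℝ) + 1) / ((n : ℝ) + 2) * (w n * w (n + 1) ^ V') +
    ((n : ℝ) + 2) / ((n : ℝ) + 1) * (w (n + 1) * w n ^ V')) - w 1 / w 0 * w n ^ (V' + 1) with hD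
  have hsumD : Summable D := hsumN.sub (hsumZ.mul_left _)
  have hdiff : N - w 1 / w 0 * Z = ∑' n, D n := by
    rw [hN, hZ, ← tsum_mul_left, ← hsumN.tsum_sub (hsumZ.mul_left _)]
  have hD0 : D 0 = 1 / 4 * (w 0 * w 1 ^ V') := by
    rw [hD]
    simp only [Nat.cast_zero, zero_add]
    rw [pow_succ]
    field_simp
    ring
  have hDtail : ∀ n, |D (n + 1)| ≤ 5 / 2 * (w 1 ^ V' * w (n + 1)) := by
    intro n
    have hr1 : w 1 / w 0 ≤ 1 := (div_le_one hw0).mpr (hanti (by norm_num))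
    have hr0 : 0 ≤ w 1 / w 0 := by positivity
    have hwn1 := hpos (n + 1)
    have hwn2 := hpos (n + 1 + 1)
    have hc1 : ((n + 1 : ℕ) : ℝ) + 1 ≤ ((n + 1 : ℕ) : ℝ) + 2 := by linarith
    have h1 : (((n + 1 : ℕ) : ℝ) + 1) / (((n + 1 : ℕ) : ℝ) + 2) ≤ 1 := by
      rw [div_le_one (by positivity)]; linarith
    have h2 : (((n + 1 : ℕ) : ℝ) + 2) / (((n + 1 : ℕ) : ℝ) + 1) ≤ 2 := by
      rw [div_le_iff₀ (by positivity)]; push_cast; linarith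
    -- the powers are at most `w_1^{V'}`
    have hp1 : w (n + 1 + 1) ^ V' ≤ w 1 ^ V' := pow_le_pow_left₀ hwn2.le (hanti (by omega)) _
    have hp2 : w (n + 1) ^ V' ≤ w 1 ^ V' := pow_le_pow_left₀ hwn1.le (hanti (by omega)) _
    have hm : w (n + 1 + 1) ≤ w (n + 1) := hanti (by omega)
    -- three nonnegative pieces
    have hA : 0 ≤ (((n + 1 : ℕ) : ℝ) + 1) / (((n + 1 : ℕ) : ℝ) + 2) * (w (n + 1) * w (n + 1 + 1) ^ V') := by
      positivity
    have hB : 0 ≤ (((n + 1 : ℕ) : ℝ) + 2) / (((n + 1 : ℕ) : ℝ) + 1) * (w (n + 1 + 1) * w (n + 1) ^ V') := by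
      positivity
    have hC : 0 ≤ w 1 / w 0 * w (n + 1) ^ (V' + 1) := by positivity
    have hA' : (((n + 1 : ℕ) : ℝ) + 1) / (((n + 1 : ℕ) : ℝ) + 2) * (w (n + 1) * w (n + 1 + 1) ^ V') ≤
        w 1 ^ V' * w (n + 1) := by
      calc _ ≤ 1 * (w (n + 1) * w (n + 1 + 1) ^ V') := mul_le_mul_of_nonneg_right h1 (by positivity)
        _ ≤ w 1 ^ V' * w (n + 1) := by
            rw [one_mul, mul_comm]; exact mul_le_mul_of_nonneg_right hp1 hwn1.le
    have hB' : (((n + 1 : ℕ) : ℝ) + 2) / (((n + 1 : ℕ) : ℝ) + 1) * (w (n + 1 + 1) * w (n + 1) ^ V') ≤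
        2 * (w 1 ^ V' * w (n + 1)) := by
      calc _ ≤ 2 * (w (n + 1 + 1) * w (n + 1) ^ V') := mul_le_mul_of_nonneg_right h2 (by positivity)
        _ ≤ 2 * (w 1 ^ V' * w (n + 1)) := by
            refine mul_le_mul_of_nonneg_left ?_ (by norm_num)
            rw [mul_comm (w 1 ^ V')]
            exact mul_le_mul hm hp2 (by positivity) hwn1.le
    have hC' : w 1 / w 0 * w (n + 1) ^ (V' + 1) ≤ w 1 ^ V' * w (n + 1) := by
      calc w 1 / w 0 * w (n + 1) ^ (V' + 1) ≤ 1 * w (n + 1) ^ (V' + 1) :=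
            mul_le_mul_of_nonneg_right hr1 (by positivity)
        _ = w (n + 1) ^ V' * w (n + 1) := by rw [one_mul, pow_succ]
        _ ≤ w 1 ^ V' * w (n + 1) := mul_le_mul_of_nonneg_right hp2 hwn1.le
    rw [hD]
    simp only
    rw [abs_le]
    constructor <;> nlinarith
  -- `|N − (w_1/w_0) Z| ≤ w_1^{V'} (¼ w_0 + (5/2) S)`
  have hsumDtail : Summable fun n => D (n + 1) := (summable_nat_add_iff 1).mpr hsumD
  have habs : |N - w 1 / w 0 * Z| ≤ w 1 ^ V' * (1 / 4 * w 0 + 5 / 2 * S) := by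
    rw [hdiff, hsumD.tsum_eq_zero_add, hD0]
    have htail : |∑' n, D (n + 1)| ≤ ∑' n, 5 / 2 * (w 1 ^ V' * w (n + 1)) := by
      have h1 : ‖∑' n, D (n + 1)‖ ≤ ∑' n, ‖D (n + 1)‖ := norm_tsum_le_tsum_norm hsumDtail.norm
      simp only [Real.norm_eq_abs] at h1
      exact h1.trans (hsumDtail.abs.tsum_le_tsum hDtail ((hsumS.mul_left _).mul_left _))
    rw [tsum_mul_left, tsum_mul_left, ← hS] at htail
    have h0 : 0 ≤ 1 / 4 * (w 0 * w 1 ^ V') := by positivity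
    calc |1 / 4 * (w 0 * w 1 ^ V') + ∑' n, D (n + 1)|
        ≤ |1 / 4 * (w 0 * w 1 ^ V')| + |∑' n, D (n + 1)| := abs_add_le _ _
      _ ≤ 1 / 4 * (w 0 * w 1 ^ V') + 5 / 2 * (w 1 ^ V' * S) := by
          rw [abs_of_nonneg h0]; exact add_le_add le_rfl htail
      _ = w 1 ^ V' * (1 / 4 * w 0 + 5 / 2 * S) := by ring
  -- divide by `Z ≥ w_0^{V'+1}`
  have hZ0 : Z ≠ 0 := hZpos.ne'
  have hw00 : w 0 ≠ 0 := hw0.ne'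
  have hkey : N / Z - w 1 / w 0 = (N - w 1 / w 0 * Z) / Z := by
    field_simp
  rw [hkey, abs_div, abs_of_pos hZpos, div_le_iff₀ hZpos]
  have hK : 0 ≤ (w 1 / w 0) ^ V' * (1 / 4 + 5 / 2 * S / w 0) := by
    have : 0 ≤ 5 / 2 * S / w 0 := by positivity
    positivity
  have heq : w 1 ^ V' * (1 / 4 * w 0 + 5 / 2 * S) =
      (w 1 / w 0) ^ V' * (1 / 4 + 5 / 2 * S / w 0) * w 0 ^ (V' + 1) := by
    rw [div_pow, pow_succ]
    field_simp
  calc |N - w 1 / w 0 * Z| ≤ w 1 ^ V' * (1 / 4 * w 0 + 5 / 2 * S) := habs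
    _ = (w 1 / w 0) ^ V' * (1 / 4 + 5 / 2 * S / w 0) * w 0 ^ (V' + 1) := heq
    _ ≤ (w 1 / w 0) ^ V' * (1 / 4 + 5 / 2 * S / w 0) * Z := mul_le_mul_of_nonneg_left hZge hK

end Abstract

/-! ## §2. The SU(2) torus plaquette: exponentially small finite-volume correction -/

/-- The dimension-normalised character coefficients `w_n = e^{−2β}(I_n(2β) − I_{n+2}(2β))/(n+1)
= e^{−2β}I_{n+1}(2β)/β` are positive (`β > 0`), antitone and summable. -/
theorem charCoeff_div_succ_pos {β : ℝ} (hβ : 0 < β) (n : ℕ) :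
    0 < Real.exp (-(2 * β)) * (besselI n (2 * β) - besselI (n + 2) (2 * β)) / ((n : ℝ) + 1) := by
  rw [charCoeff_div_succ_eq_besselI n hβ.ne']
  have := besselI_pos (n + 1) (show 0 < 2 * β by linarith)
  positivity

/-- Antitone: `w_{n+1} ≤ w_n` (`I_{n+2} ≤ I_{n+1}`). -/
theorem charCoeff_div_succ_antitone {β : ℝ} (hβ : 0 < β) :
    Antitone fun n : ℕ => Real.exp (-(2 * β)) * (besselI n (2 * β) - besselI (n + 2) (2 * β)) /
      ((n : ℝ) + 1) := by
  refine antitone_nat_of_succ_le fun n => ?_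
  rw [charCoeff_div_succ_eq_besselI n hβ.ne', charCoeff_div_succ_eq_besselI (n + 1) hβ.ne']
  refine div_le_div_of_nonneg_right (mul_le_mul_of_nonneg_left ?_ (Real.exp_nonneg _)) hβ.le
  exact besselI_succ_le (n + 1) (by linarith)

/-- Summable (it is the partition function of the `1 × 1` torus). -/
theorem summable_charCoeff_div_succ {β : ℝ} (hβ : 0 ≤ β) :
    Summable fun n : ℕ => Real.exp (-(2 * β)) * (besselI n (2 * β) - besselI (n + 2) (2 * β)) /
      ((n : ℝ) + 1) := by
  have h := (hasSum_partitionFunction_su2_two (L := 1) hβ).summable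
  simpa using h

/-- **THE FINITE-VOLUME CORRECTION OF THE SU(2) TORUS PLAQUETTE IS EXPONENTIALLY SMALL IN THE
VOLUME.**  For `β > 0`, every `L ≥ 1` and plaquette `x₀` of `(ℤ/L)²`:
`|⟨a₀(U_{x₀})⟩_{(ℤ/L)²,β} − I₂(2β)/I₁(2β)| ≤ (I₂(2β)/I₁(2β))^{L²−1} · (¼ + (5/2)·Σ_n I_{n+2}(2β)/I₁(2β))`,
`I₂(2β)/I₁(2β)` being the infinite-volume (one-plaquette) value of the cell's reference table at
`b = 2β`. -/
theorem abs_wilson_mean_su2a0_plaquette_two_sub_le {L : ℕ} [NeZero L] {β : ℝ} (hβ : 0 < β)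
    (x₀ : Site 2 L) :
    |∫ V, su2a0 (plaquetteHolonomy V x₀ 0 1) ∂(wilsonMeasure (d := 2) (L := L) (fundamentalRep (Fin 2)) β) -
        besselI 2 (2 * β) / besselI 1 (2 * β)| ≤
      (besselI 2 (2 * β) / besselI 1 (2 * β)) ^ (L ^ 2 - 1) *
        (1 / 4 + 5 / 2 * (∑' n : ℕ, besselI (n + 2) (2 * β)) / besselI 1 (2 * β)) := by
  set w : ℕ → ℝ := fun n => Real.exp (-(2 * β)) * (besselI n (2 * β) - besselI (n + 2) (2 * β)) /
    ((n : ℝ) + 1) with hw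
  have hanti : Antitone w := charCoeff_div_succ_antitone hβ
  have hpos : ∀ n, 0 < w n := charCoeff_div_succ_pos hβ
  have hsum : Summable w := summable_charCoeff_div_succ hβ.le
  have hV : 1 ≤ L ^ 2 := Nat.one_le_pow _ _ (Nat.pos_of_ne_zero (NeZero.ne L))
  have habs := abs_div_tsum_sub_le hanti hpos hsum (L ^ 2) hV
  -- identify the series of the plaquette theorem with the `w`-series
  have hw' : ∀ n, w n = Real.exp (-(2 * β)) * besselI (n + 1) (2 * β) / β := fun n =>
    charCoeff_div_succ_eq_besselI n hβ.ne'
  have hc : ∀ n : ℕ, Real.exp (-(2 * β)) * (besselI n (2 * β) - besselI (n + 2) (2 * β)) =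
      ((n : ℝ) + 1) * w n := by
    intro n
    rw [hw]
    simp only
    field_simp
  have hI1 : 0 < besselI 1 (2 * β) := besselI_pos 1 (by linarith)
  have he : 0 < Real.exp (-(2 * β)) := Real.exp_pos _
  have hratio : w 1 / w 0 = besselI 2 (2 * β) / besselI 1 (2 * β) := by
    rw [hw' 1, hw' 0]
    field_simp
  have hS : 5 / 2 * (∑' n : ℕ, w (n + 1)) / w 0 =
      5 / 2 * (∑' n : ℕ, besselI (n + 2) (2 * β)) / besselI 1 (2 * β) := by
    have h1 : (fun n : ℕ => w (n + 1)) = fun n => (Real.exp (-(2 * β)) / β) * besselI (n + 2) (2 * β) := by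
      funext n; rw [hw' (n + 1)]; ring
    rw [h1, tsum_mul_left, hw' 0]
    field_simp
  have hnum : ∀ n : ℕ, (1 / 2 : ℝ) *
      ((Real.exp (-(2 * β)) * (besselI n (2 * β) - besselI (n + 2) (2 * β))) *
          (Real.exp (-(2 * β)) * (besselI (n + 1) (2 * β) - besselI (n + 1 + 2) (2 * β))) ^ (L ^ 2 - 1) *
          ((((n : ℝ) + 1 + 1) ^ (L ^ 2)))⁻¹ +
        (Real.exp (-(2 * β)) * (besselI (n + 1) (2 * β) - besselI (n + 1 + 2) (2 * β))) *
          (Real.exp (-(2 * β)) * (besselI n (2 * β) - besselI (n + 2) (2 * β))) ^ (L ^ 2 - 1) *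
          ((((n : ℝ) + 1) ^ (L ^ 2)))⁻¹) =
      (1 / 2 : ℝ) * (((n : ℝ) + 1) / ((n : ℝ) + 2) * (w n * w (n + 1) ^ (L ^ 2 - 1)) +
        ((n : ℝ) + 2) / ((n : ℝ) + 1) * (w (n + 1) * w n ^ (L ^ 2 - 1))) := by
    intro n
    obtain ⟨V', hV'⟩ : ∃ V', L ^ 2 = V' + 1 := ⟨L ^ 2 - 1, by omega⟩
    rw [hc n, hc (n + 1), hV', Nat.add_sub_cancel, mul_pow, mul_pow, pow_succ, pow_succ]
    push_cast
    have h1 : ((n : ℝ) + 1) ≠ 0 := by positivity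
    have h2 : ((n : ℝ) + 1 + 1) ≠ 0 := by positivity
    have h3 : ((n : ℝ) + 1) ^ V' ≠ 0 := by positivity
    have h4 : ((n : ℝ) + 1 + 1) ^ V' ≠ 0 := by positivity
    field_simp
    ring
  have hden : ∀ n : ℕ, (Real.exp (-(2 * β)) * (besselI n (2 * β) - besselI (n + 2) (2 * β)) /
      ((n : ℝ) + 1)) ^ (L ^ 2) = w n ^ (L ^ 2) := fun n => rfl
  rw [wilson_mean_su2a0_plaquette_two hβ.le x₀, tsum_congr hnum, tsum_congr hden, ← hratio, ← hS]
  exact habs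

end Summit.Ventures.LatticeQCDFlow.Scoring
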